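import Summits.BirchSwinnertonDyer.Rank1Residual.X2.ResidualDevissageLine
import Summits.BirchSwinnertonDyer.Rank1Residual.X2.GreenbergVatsalTransferMultiplicative
import HarnessLib

/-!
# Greenberg–Vatsal 2000, §2 at a multiplicative Eisenstein prime, first case of `GVPar`:
# `E(ℚ_∞)[p^∞] = 0` — the correction term of Prop. (2.8) vanishes (kernel theorem)

HONEST FRAMING (cell `b2b-bsdres`, run/shared/lean/b2b/bsd-rank1-residual/, verbatim in every
file): the goal of the cell is to DELETE the COMBINATION-SHAPED residual classes of the
Birch–Swinnerton-Dyer formula for ALL analytic-rank `≤ 1` elliptic curves over `ℚ` — "full BSD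
formula for every rank `≤ 1` curve in class `C`" assembled STRICTLY from published theorems — so
that the rank-`≤ 1` remainder becomes exactly the CONSTRUCTION-SHAPED classes, which are TYPED
(missing-input `Prop`s), NOT attempted. This is not "finishing BSD". Sub-cell
`b2b-bsdres-eisenstein-p2` (CLASS-OWNERS row "X2"), gen 16: research route; NO CLAIM BEYOND STATED
CLASSES; nothing here changes a label; no new named fact; theorems only.

WHAT. Greenberg–Vatsal's Prop. (2.8) (`S^{Σ₀}_A(ℚ_∞)[π] ≅ S^{Σ₀}_{A[π]}(ℚ_∞)`) is printed under
"`H⁰(ℚ, A[π]) = 0`"; the cell's kernel version (gen 8, `GreenbergVatsalTorsionCurve`) carries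
instead the correction term `#(E(L)[p^∞]/p)`. In GV's FIRST CASE at an odd `p ‖ N` — `E[p]` has a
rational line `Φ₀` RAMIFIED at `p` and EVEN — the correction vanishes: `E(ℚ_∞)[p^∞]` is fixed by
all of `Γ_ℚ` (gen 9, `GreenbergVatsalTateDatumTorsion.smul_eq_of_mem_fixedPoints_kerSubgroup`,
Mazur 6.12 on the Tate line; modulo the twisted Tate uniformisation A41), a nonzero element would
yield a `Γ_ℚ`-fixed point of order `p`, and `E[p]^{Γ_ℚ} = 0` in case 1 (gen 16,
`ResidualDevissageLine.eq_zero_of_forall_smul_eq`). So GV's sentence "we may assume … that `φ` is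
ramified and even, `ψ` is unramified and odd. It follows immediately that `H⁰(ℚ, E[p]) = 0`"
(p. 28) holds over `ℚ_∞` too, as a THEOREM, and display (16) at `p ‖ N` takes its printed shape
`dim S^{Σ₀}_{E[p]}(ℚ_∞) = λ_E + Σδ + e_p` (no correction term).

CONTENT. `smul_eq_of_mem_fixedPoints_of_hasMultiplicativeReductionAtPrime` (every `σ ∈ Γ_ℚ` fixes
`E(ℚ_∞)[p^∞]` at an odd `p ‖ N`; A41 as `hT`); **`fixedPoints_kerSubgroup_eq_bot_of_line`**
(`E(ℚ_∞)[p^∞] = 0` in case 1); `natCard_fixedPoints_quot_eq_one_of_line` (the correction factor of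
`GreenbergVatsalTorsionCurve.natCard_gvSelmer_torsion_curve` is `1`).

References: Greenberg–Vatsal, Invent. Math. 142 (2000) = arXiv:math/9906215, §2 Prop. (2.8),
pp. 25–28; Greenberg, LNM 1716 §1 p. 62, §3 p. 86; Silverman, *Advanced Topics* V.5.3–5.4.
-/

noncomputable section

open scoped Classical AddSubgroup

namespace Summit.BirchSwinnertonDyer.Rank1Residual.X2.ResidualDevissageNoTorsion

open NumberField IsDedekindDomain Field WeierstrassCurve
open Literature.NumberTheory.EllipticCurves Literature.NumberTheory.EllipticCurves.GreenbergSelmer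
  Literature.NumberTheory.GaloisRepresentations IsDedekindDomain.HeightOneSpectrum
  Literature.NumberTheory.EllipticCurves.Rank1Residual
  Summit.BirchSwinnertonDyer.Rank1Residual.X2.GreenbergVatsalTorsion
  Summit.BirchSwinnertonDyer.Rank1Residual.X2.GreenbergVatsalTateDatum
  Summit.BirchSwinnertonDyer.Rank1Residual.X2.GreenbergVatsalTateDatumRat
  Summit.BirchSwinnertonDyer.Rank1Residual.X2.GreenbergVatsalTateDatumTorsion
  Summit.BirchSwinnertonDyer.Rank1Residual.X2.ResidualDevissageModules
  Summit.BirchSwinnertonDyer.Rank1Residual.X2.ResidualDevissageLine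

variable (W : WeierstrassCurve ℚ) [W.IsElliptic] [W.IsGloballyMinimal] (p : ℕ) [hp : Fact p.Prime]
  (κ : ZpExtension ℚ p)

/-! ## §1. `Γ_ℚ` fixes `E(ℚ_∞)[p^∞]` at an odd `p ‖ N` -/

/-- **Every `σ ∈ Γ_ℚ` fixes `E(ℚ_∞)[p^∞]`** for the cyclotomic `ℤ_p`-extension at an odd `p ‖ N`
of the globally minimal `E/ℚ` (so `E(ℚ_∞)[p^∞] = E(ℚ)[p^∞]`): the Tate data over `ℚ` from the
twisted uniformisation (`hT`, A41) fed to gen 9's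
`GreenbergVatsalTateDatumTorsion.smul_eq_of_mem_fixedPoints_kerSubgroup` (Mazur 6.12 on the Tate
line). [cite: GreenbergLNM1716, §1 p. 62; §3 p. 86]
[cite: SilvermanATAEC1994, Ch. V Lemma 5.2 (c), Thm. 5.3 (a),(b), Cor. 5.4 (held copy PDF pp. 406–410)] -/
theorem smul_eq_of_mem_fixedPoints_of_hasMultiplicativeReductionAtPrime
    (hT : Silverman1994_thmV53_corV54_tateUniformisation.{0}) (hp2 : p ≠ 2)
    (hmult : W.HasMultiplicativeReductionAtPrime p) (hκ : κ.IsCyclotomic)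
    (σ : absoluteGaloisGroup ℚ) {b : W.geomPrimaryTorsion p}
    (hb : b ∈ FixedPoints.addSubgroup κ.kerSubgroup (W.geomPrimaryTorsion p)) : σ • b = b := by
  set v : HeightOneSpectrum (𝓞 ℚ) := (Rat.HeightOneSpectrum.primesEquiv (R := 𝓞 ℚ)).symm ⟨p, hp.out⟩
    with hvdef
  have hv : ((p : ℕ) : 𝓞 ℚ) ∈ v.asIdeal :=
    (natCast_mem_asIdeal_iff_eq_primesEquiv_symm v hp.out).mpr hvdef
  have hmultv : W.HasMultiplicativeReductionAt v :=
    GreenbergVatsalTransferMultiplicative.hasMultiplicativeReductionAt_of_natCast_mem W p hmult hv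
  obtain ⟨q, t, Ψ, hq0, hq1, -, ht2, hsurj, hker, hΨσ, -⟩ := hT W v hmultv
  have ht := inertia_fix_sqrt_gamma W hp2 hmult hv t ht2
  have hΨ : ∀ (σ : absoluteGaloisGroup (v.adicCompletion ℚ))
      (u : (AlgebraicClosure (v.adicCompletion ℚ))ˣ),
      σ • Ψ (Additive.ofMul u) = Ψ (Additive.ofMul (Units.map
        (Field.absoluteGaloisGroup.toAlgEquiv (v.adicCompletion ℚ) σ :
          AlgebraicClosure (v.adicCompletion ℚ) →* AlgebraicClosure (v.adicCompletion ℚ)) u)) ∨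
      σ • Ψ (Additive.ofMul u) = -Ψ (Additive.ofMul (Units.map
        (Field.absoluteGaloisGroup.toAlgEquiv (v.adicCompletion ℚ) σ :
          AlgebraicClosure (v.adicCompletion ℚ) →* AlgebraicClosure (v.adicCompletion ℚ)) u)) := by
    intro σ u
    rw [hΨσ σ u]
    split_ifs
    · exact Or.inl (one_zsmul _)
    · exact Or.inr (neg_one_zsmul _)
  have hΨI : ∀ σ ∈ absInertia (v.adicCompletion ℚ),
      ∀ u : (AlgebraicClosure (v.adicCompletion ℚ))ˣ,
      σ • Ψ (Additive.ofMul u) = Ψ (Additive.ofMul (Units.map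
        (Field.absoluteGaloisGroup.toAlgEquiv (v.adicCompletion ℚ) σ :
          AlgebraicClosure (v.adicCompletion ℚ) →* AlgebraicClosure (v.adicCompletion ℚ)) u)) := by
    intro σ hσ u
    rw [hΨσ σ u, if_pos (ht σ hσ), one_zsmul]
  exact smul_eq_of_mem_fixedPoints_kerSubgroup W p Ψ hΨ hq0 hq1 (fun u h ↦ (hker u).1 h) hΨI κ hκ
    hp2 hv hsurj σ hb

/-! ## §2. `E(ℚ_∞)[p^∞] = 0` in Greenberg–Vatsal's first case -/

variable {Φ₀ : AddSubgroup (W.geomTorsion (p : ℤ))} (hΦ : IsRationalLine W p Φ₀)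

omit [W.IsGloballyMinimal] in
include hΦ in
/-- A `Γ_ℚ`-fixed element of `E[p^∞]` is `0` when `E[p]` has a rational line that is ramified at
`p` and even (`p` odd): its last nonzero `p`-power multiple would be a fixed point of `E[p]`,
excluded by `ResidualDevissageLine.eq_zero_of_forall_smul_eq`. [cite: GreenbergVatsal2000, §2 p. 28] -/
theorem eq_zero_of_forall_smul_eq_primary (hp2 : p ≠ 2) (hram : ¬ LineUnramifiedAt W p Φ₀)
    (heven : LineEven W p Φ₀) (b : W.geomPrimaryTorsion p)
    (hb : ∀ σ : absoluteGaloisGroup ℚ, σ • b = b) : b = 0 := by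
  by_contra hb0
  -- the least `n` with `p^n • b = 0`
  obtain ⟨k, hk⟩ := b.2
  have hex : ∃ n : ℕ, p ^ n • b = 0 := ⟨k, Subtype.ext (by
    rw [AddSubmonoidClass.coe_nsmul, ZeroMemClass.coe_zero]
    exact hk)⟩
  have hn0 : Nat.find hex ≠ 0 := fun h0 ↦ hb0 (by
    have := Nat.find_spec hex
    rwa [h0, pow_zero, one_nsmul] at this)
  obtain ⟨m, hm⟩ : ∃ m : ℕ, Nat.find hex = m + 1 := Nat.exists_eq_succ_of_ne_zero hn0
  set c : W.geomPrimaryTorsion p := p ^ m • b with hcdef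
  have hpc : p • c = 0 := by
    rw [hcdef, ← mul_nsmul', ← pow_succ', ← hm]
    exact Nat.find_spec hex
  have hc0 : c ≠ 0 := fun h ↦ Nat.find_min hex (m := m) (by rw [hm]; exact Nat.lt_succ_self m) h
  have hcfix : ∀ σ : absoluteGaloisGroup ℚ, σ • c = c := fun σ ↦ by
    rw [hcdef]
    change DistribSMul.toAddMonoidHom (W.geomPrimaryTorsion p) σ (p ^ m • b) = _
    rw [map_nsmul, DistribSMul.toAddMonoidHom_apply, hb σ]
  -- `c` as a point of `E[p^∞][p]`, then of `E[p]`
  let c' : (↥(W.geomPrimaryTorsion p))[(p : ℤ)] := ⟨c, AddSubgroup.torsionBy.nsmul_iff.mpr hpc⟩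
  obtain ⟨P, hP⟩ := (ResidualDevissageLine.torsionToPrimary_bijective W p).2 c'
  have hPfix : ∀ σ : absoluteGaloisGroup ℚ, σ • P = P := fun σ ↦
    (ResidualDevissageLine.torsionToPrimary_bijective W p).1 (by
      rw [ResidualDevissageLine.torsionToPrimary_smul, hP]
      exact Subtype.ext (hcfix σ))
  have hP0 : P = 0 := ResidualDevissageLine.eq_zero_of_forall_smul_eq hΦ hp2 hram heven P hPfix
  apply hc0
  have : c' = 0 := by rw [← hP, hP0, map_zero]
  exact congrArg Subtype.val this

include hΦ in
/-- **`E(ℚ_∞)[p^∞] = 0` in Greenberg–Vatsal's first case at an odd `p ‖ N`** (`Φ₀` a rational line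
ramified at `p` and even; `κ` cyclotomic; A41 as `hT`). [cite: GreenbergVatsal2000, §2 Prop. (2.8), p. 28]
[cite: GreenbergLNM1716, §1 p. 62; §3 p. 86] -/
theorem fixedPoints_kerSubgroup_eq_bot_of_line
    (hT : Silverman1994_thmV53_corV54_tateUniformisation.{0}) (hp2 : p ≠ 2)
    (hmult : W.HasMultiplicativeReductionAtPrime p) (hκ : κ.IsCyclotomic)
    (hram : ¬ LineUnramifiedAt W p Φ₀) (heven : LineEven W p Φ₀) :
    (FixedPoints.addSubgroup κ.kerSubgroup (W.geomPrimaryTorsion p) :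
      AddSubgroup (W.geomPrimaryTorsion p)) = ⊥ := by
  rw [eq_bot_iff]
  intro b hb
  rw [AddSubgroup.mem_bot]
  exact eq_zero_of_forall_smul_eq_primary W p hΦ hp2 hram heven b fun σ ↦
    smul_eq_of_mem_fixedPoints_of_hasMultiplicativeReductionAtPrime W p κ hT hp2 hmult hκ σ hb

include hΦ in
/-- **The correction factor of Prop. (2.8) is `1`** in Greenberg–Vatsal's first case at an odd
`p ‖ N`: `#(E(ℚ_∞)[p^∞] / p·E(ℚ_∞)[p^∞]) = 1`. [cite: GreenbergVatsal2000, §2 Prop. (2.8), p. 28] -/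
theorem natCard_fixedPoints_quot_eq_one_of_line
    (hT : Silverman1994_thmV53_corV54_tateUniformisation.{0}) (hp2 : p ≠ 2)
    (hmult : W.HasMultiplicativeReductionAtPrime p) (hκ : κ.IsCyclotomic)
    (hram : ¬ LineUnramifiedAt W p Φ₀) (heven : LineEven W p Φ₀) :
    Nat.card (FixedPoints.addSubgroup κ.kerSubgroup (W.geomPrimaryTorsion p) ⧸
        (nsmulAddMonoidHom
          (α := FixedPoints.addSubgroup κ.kerSubgroup (W.geomPrimaryTorsion p)) p).range) = 1 := by
  have hbot := fixedPoints_kerSubgroup_eq_bot_of_line W p κ hΦ hT hp2 hmult hκ hram heven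
  haveI : Subsingleton (FixedPoints.addSubgroup κ.kerSubgroup (W.geomPrimaryTorsion p)) := by
    rw [hbot]
    infer_instance
  haveI : Subsingleton (FixedPoints.addSubgroup κ.kerSubgroup (W.geomPrimaryTorsion p) ⧸
      (nsmulAddMonoidHom
        (α := FixedPoints.addSubgroup κ.kerSubgroup (W.geomPrimaryTorsion p)) p).range) :=
    Quot.Subsingleton
  exact Nat.card_of_subsingleton 0

end Summit.BirchSwinnertonDyer.Rank1Residual.X2.ResidualDevissageNoTorsion

end
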